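import Literature.MathematicalPhysics.QuantumFieldTheory.Balaban1983to89.HiggsDoubleRTRescale
import Literature.MathematicalPhysics.QuantumFieldTheory.Balaban1983to89.B1Ineq337HiggsModel

/-!
# `Balaban1983to89.HiggsBackgroundRescale` — T. Bałaban, *(Higgs)₂,₃ quantum fields in a finite volume. I. A lower bound*,
Commun. Math. Phys. **85** (1982) 603–626 [Balaban1982Higgs1], p. 607 (1.22)–(1.23), p. 610 (2.20)/(2.22), p. 617 (3.29),
p. 618–619 (3.37)→(3.38): the rescaling *"of all the fields AND THE PROPAGATORS from L^kε-lattice to 1-lattice"* — the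
background field `A^{(k),ε} = a_k(L^kε)^{−2}G^ε_kQ^*_kA` of (3.29) is COVARIANT under the canonical rescaling (1.22)
(`A^{(k),ε}[σA′] = σ·A^{(k),sε}[A′]` with the vector mass `μ₀²` replaced by `μ₀²s⁻²`, p. 607), hence the (3.37) integral of
the (Higgs)₂,₃ model transforms into `const ×` the corresponding integral over the fields of the rescaled lattices —
the model instance of `HiggsDoubleRTRescale`, PROVED

statement-level skeleton of published theorems with citation tags; proofs where landed; nothing here is a claim about the Yang–Mills mass gap

PDF held: `paper:balaban1982-cmp85-higgs23-i` (journal page = PDF page + 602).  pp. 607, 610, 617–619 read from the ×2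
renders `run/shared/lean/pub/pub-balaban/b2b-balaban-ref1/pages/1982-cmp85-higgs23-I/…-p005/p008/p015/p016/p017-x2.png`.

CITATION HEADER (lean-in-tree rule).  lit-balaban typed skeleton (HOME `run/shared/lean/pub/lit-balaban/`), typer line
(carrier API; rows of record unchanged): rows **B1.Eq2.20 / B1.Eq2.22** (r14; `HiggsCovariance.propagatorK`, (2.22) the
rescaled propagators), **B1.Eq3.29** (r12/r14; `B1LowerBound.bgField`, concrete `B3MultiscaleFields.topPiece` =
`B1Eq31Concrete.bgVec`), **B1.Eq3.37-3.38** (r12; (3.38) member).  WHAT IS REPRODUCED.  p. 610 [PDF 8], verbatim (text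
layer `p0008.txt` ll. 20–23): *"In the sequel the properties of the propagator G^ε_k(Ω, A) rescaled to the η-lattice,
η = L^{−k}, will be very important. Let us notice that the rescaled propagator is given by
G_k(Ω, A) = (−Δ^η_A + m²(Lᵏε)² + a_kP_k(A))^{−1}. (2.22)"* (v1.1 ERRATUM, docstrings only: v1 of this header and of
`propagatorK_zero_rescale` rendered this passage as *"Of course we have to rescale these propagators also in order to get
propagators on the unit lattice: … (2.22)"*, which is NOT the printed wording — found by the typer's g19 quotation audit
`HOME/lit-balaban-typer/QUOTE-AUDIT.md`; no declaration is touched); p. 618–619 [PDF 16–17]: *"The first step in the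
calculation is a rescaling of all the fields and the propagators
from L^kε-lattice T^{(k)}_{L^kε} to 1-lattice T^{(k)}_1. After the rescaling the integral transforms into the integral
const χ_{k+1}(B)χ_{k+1}(ψ)∫dA∫dφ χ_k(A)χ_k(φ)exp[−½aL^{d−2}Σ|B(y)−(QA)(y)|² − ½aL^{d−2}Σ|ψ(y)−(Q(A^{(k)})φ)(y)|² − …]
(3.38)"* with p. 607 *"the constants m₀², μ₀² are replaced by m₀²s⁻², μ₀²s⁻²"*.  DICTIONARY: the two families `P`
(spacings `L^jε`) and `P.scaleBy s hs` (spacings `L^j sε`; in print `s = (L^kε)^{−1}`), the rescalings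
`HiggsRescaling.rescaleScalar/rescaleVec` (`= σ·`, `σ = s^{(d−2)/2}`, same labels); the operators at the ZERO external
field on the whole torus (the case of (3.29)): `−Δ^ε` = `HiggsCovariance.covLaplacianN (zeroCharge d) univ 0`, `Q_k`,
`Q_k^*`, `P_k` = `avgQkLin/avgQkAdj/projPk … 0 k`, `−Δ^ε + μ₀² + a_k(L^kε)^{−2}P_k` = `covOpK`, `G^ε_k` = `propagatorK`,
`a_k(L^kε)^{−2}G^ε_kQ^*_k` = `B3MultiscaleFields.fluctOp`, `A^{(k),ε}` = `B1Eq31Concrete.bgVec`; the double transformation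
of (3.37) = `HiggsDoubleRT.doubleRTk C a (A ↦ A^{(k),ε})` and its (3.37) integrand `B1Ineq337HiggsModel.cutoffDensity`.
PROVED, in this order: (§1) at the zero field the label-preserving operators commute with `σ·` and the spacing-dependent
ones scale: `Q_k(σf′) = σQ_kf′`, `Q^*_k(σg′) = σQ^*_kg′`, `P_k(σf′) = σP_kf′`, `(−Δ^ε)(σf′) = s²σ(−Δ^{sε})f′`,
`(−Δ^ε + μ₀² + a_k(L^kε)^{−2}P_k)(σf′) = s²σ(−Δ^{sε} + μ₀²s⁻² + a_k(L^ksε)^{−2}P_k)f′` (`covOpK_zero_rescale`), hence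
**`G^ε_k(μ₀²)(σg′) = s⁻²σ·G^{sε}_k(μ₀²s⁻²)g′`** (`propagatorK_zero_rescale`, for `μ₀² > 0`, `a_k ≥ 0`: from `G(−Δ+…) =
1` on both lattices, no operator algebra on `Ring.inverse`) and `a_k(L^kε)^{−2}G^εQ^*(σg′) = σ·a_k(L^ksε)^{−2}G^{sε}Q^*g′`
(`fluctOp_rescale` — the combination (3.29) is scale-free); (§2) **`bgVec_rescale`**: `A^{(k),ε}[σA′] = σ·A^{(k),sε}_{μ₀²s⁻²}
[A′]`; (§3) the (3.37)→(3.38) rescaling FOR THE MODEL: `doubleRTk_rescale_bg` (the double transformation at the external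
field `A^{(k),ε}`) and **`integral337_rescale`** — `∫dB∫dψ χ_{k+1}(B)χ_{k+1}(ψ)T^{L^kε}T^{L^kε}_{A^{(k),ε}}[χ_kχ_ke^{−S}] =
const · ∫dB′∫dψ′ χ_{k+1}(σB′)χ_{k+1}(σψ′)·T^{sε-family}T_{A^{(k),sε}}[(χ_kχ_ke^{−S})(σ·,σ·)](B′,ψ′)` with the explicit
constant of `HiggsDoubleRTRescale`.
HONEST SCOPE / NOT HERE: the identification of the rescaled weights `χ_k(σA′)`, `χ_{k+1}(σB′)` with characteristic
functions written on the rescaled lattices (the (3.8)–(3.9)-type covariance of (3.27)–(3.28), row B1.Eq3.8-3.9) and of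
`S(σ·,σ·)` with the unit-lattice effective action displayed in (3.38) (rows B1.Eq3.30–3.36) — both absent; general
external fields `A ≠ 0` in the propagators (only the zero-field case enters (3.29)).
Unit `lit-balaban-typer` gen 3 (literature-prover-lit-balaban-typer-g3-0); v1.1 (gen 19, literature-prover-lit-balaban-typer-g19-0)
= DOCSTRING-ONLY erratum of the p. 610 (2.22) quotation (header + `propagatorK_zero_rescale`), every declaration byte-identical;
HOME/FILED.md records the proposals.
-/

open scoped BigOperators
open _root_.MeasureTheory

namespace Literature.MathematicalPhysics.QuantumFieldTheory.Balaban1983to89.HiggsBackgroundRescale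

open Literature.MathematicalPhysics.QuantumFieldTheory.Balaban1983to89.HiggsLattice
open Literature.MathematicalPhysics.QuantumFieldTheory.Balaban1983to89.HiggsAveraging
open Literature.MathematicalPhysics.QuantumFieldTheory.Balaban1983to89.HiggsCovariance
open Literature.MathematicalPhysics.QuantumFieldTheory.Balaban1983to89.HiggsCovariancePos
open Literature.MathematicalPhysics.QuantumFieldTheory.Balaban1983to89.HiggsRescaling
open Literature.MathematicalPhysics.QuantumFieldTheory.Balaban1983to89.HiggsDoubleRT
open Literature.MathematicalPhysics.QuantumFieldTheory.Balaban1983to89.HiggsDoubleRTRescale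
open Literature.MathematicalPhysics.QuantumFieldTheory.Balaban1983to89.B3MultiscaleFields
  (toSite ofSite topPiece fluctOp fluctOp_eq zeroCharge zeroCharge_U qStar_apply)
open Literature.MathematicalPhysics.QuantumFieldTheory.Balaban1983to89.B2Eq21FirstStep (toSite_rescaleVec)
open Literature.MathematicalPhysics.QuantumFieldTheory.Balaban1983to89.B1Eq31Concrete (bgVec chiKA chiKφ covLaplacianN_univ_apply)
open Literature.MathematicalPhysics.QuantumFieldTheory.Balaban1983to89.B1Ineq337HiggsModel (aSeq_nonneg cutoffDensity)

variable {P : Params} {k N : ℕ} {s : ℝ}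

/-! ## 1. The zero-field operators of (3.29) under the rescaling (1.22) -/

section Operators

/-- The rescaling (1.22) is additive. [cite: Balaban1982Higgs1, (1.22) p.607] -/
theorem rescaleScalar_add (hs : 0 < s) (f g : ScalarField (P.scaleBy s hs) k N) :
    rescaleScalar hs (f + g) = rescaleScalar hs f + rescaleScalar hs g := by
  funext x
  simp [rescaleScalar, smul_add]

/-- The rescaling (1.22) commutes with scalars. [cite: Balaban1982Higgs1, (1.22) p.607] -/
theorem rescaleScalar_smul (hs : 0 < s) (c : ℝ) (f : ScalarField (P.scaleBy s hs) k N) :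
    rescaleScalar hs (c • f) = c • rescaleScalar hs f := by
  funext x
  simp [rescaleScalar, smul_comm c]

/-- The same labels: the dimension, the block size and hence `a_k` of the rescaled family are those of `P`
(definitional). [cite: Balaban1982Higgs1, (1.22) p.607] -/
theorem aSeq_scaleBy (hs : 0 < s) (a : ℝ) (k : ℕ) : B1.aSeq a (P.scaleBy s hs).L k = B1.aSeq a P.L k := rfl

/-- The same labels: the block size of the rescaled family (definitional). [cite: Balaban1982Higgs1, (1.22) p.607] -/
theorem scaleBy_L (hs : 0 < s) : (P.scaleBy s hs).L = P.L := rfl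

/-- The same labels: the block points `x ↦ x_k` ((2.2) p. 608) of the two families agree (the iterated-block map does not
involve the spacing; proved by induction on `k`, the recursion not being unfolded definitionally). [cite: Balaban1982Higgs1, (2.2) p.608] -/
theorem blockIter_scaleBy (hs : 0 < s) : ∀ (k : ℕ) (x : Site P 0),
    blockIter (P := P.scaleBy s hs) k x = blockIter (P := P) k x
  | 0, _ => rfl
  | k + 1, x => by
    show blockOf (P := P.scaleBy s hs) (blockIter (P := P.scaleBy s hs) k x) = blockOf (blockIter k x)
    rw [blockIter_scaleBy hs k x]
    rfl

/-- The same labels: the iterated blocks `B^k(y)` ((1.20) p. 607) of the two families agree. [cite: Balaban1982Higgs1, (1.20) p.607] -/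
theorem blockK_scaleBy (hs : 0 < s) (k : ℕ) (y : Site P k) :
    blockK (P := P.scaleBy s hs) k y = blockK (P := P) k y := by
  ext x
  exact ⟨fun hx => (mem_blockK (P := P) k y x).2
      ((blockIter_scaleBy (P := P) hs k x).symm.trans ((mem_blockK (P := P.scaleBy s hs) k y x).1 hx)),
    fun hx => (mem_blockK (P := P.scaleBy s hs) k y x).2
      ((blockIter_scaleBy (P := P) hs k x).trans ((mem_blockK (P := P) k y x).1 hx))⟩

/-- `ℝ^d`-valued site functions back to bond functions commute with `σ·`: `ofSite (σh′) = σ·ofSite h′` across the two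
families. [cite: Balaban1982Higgs1, (1.22) p.607] -/
theorem ofSite_rescaleScalar (hs : 0 < s) (h : ScalarField (P.scaleBy s hs) k P.d) :
    ofSite (rescaleScalar (N := P.d) hs h) = rescaleVec hs (ofSite (P := P.scaleBy s hs) h) := by
  funext b
  simp [ofSite, rescaleVec, rescaleScalar]

/-- **`Q_k` (2.11) at the zero field commutes with the rescaling** (plain `L^{−kd}`-weighted block sums, same labels).
[cite: Balaban1982Higgs1, (2.11) p.609] -/
theorem avgQkLin_zero_rescale (hs : 0 < s) (k : ℕ) (f : ScalarField (P.scaleBy s hs) 0 P.d) :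
    avgQkLin (zeroCharge P.d) (0 : VecField P 0) k (rescaleScalar (N := P.d) hs f)
      = rescaleScalar (N := P.d) hs (avgQkLin (P := P.scaleBy s hs) (zeroCharge P.d) 0 k f) := by
  funext y
  rw [avgQkLin_apply, avgQk_apply]
  simp only [rescaleScalar]
  erw [avgQkLin_apply, avgQk_apply]
  simp only [zeroCharge_U, one_apply_eq_self, ← Finset.smul_sum]
  rw [smul_comm, blockK_scaleBy hs k y]
  rfl

/-- **`Q_k^*` (2.20) at the zero field commutes with the rescaling** (`(Q_k^*g)(x) = g(x_k)`,
`B3MultiscaleFields.qStar_apply`). [cite: Balaban1982Higgs1, (2.20) p.610] -/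
theorem avgQkAdj_zero_rescale (hs : 0 < s) (k : ℕ) (g : ScalarField (P.scaleBy s hs) k P.d) :
    avgQkAdj (zeroCharge P.d) (0 : VecField P 0) k (rescaleScalar (N := P.d) hs g)
      = rescaleScalar (N := P.d) hs (avgQkAdj (P := P.scaleBy s hs) (zeroCharge P.d) 0 k g) := by
  funext x
  rw [qStar_apply]
  simp only [rescaleScalar]
  erw [qStar_apply]
  rw [blockIter_scaleBy hs k x]

/-- `P_k = Q_k^*Q_k` at the zero field commutes with the rescaling. [cite: Balaban1982Higgs1, (2.17) p.610] -/
theorem projPk_zero_rescale (hs : 0 < s) (k : ℕ) (f : ScalarField (P.scaleBy s hs) 0 P.d) :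
    projPk (zeroCharge P.d) (0 : VecField P 0) k (rescaleScalar (N := P.d) hs f)
      = rescaleScalar (N := P.d) hs (projPk (P := P.scaleBy s hs) (zeroCharge P.d) 0 k f) := by
  unfold projPk
  rw [LinearMap.comp_apply, LinearMap.comp_apply, avgQkLin_zero_rescale, avgQkAdj_zero_rescale]

/-- **The Laplacian scales by `s²`**: `(−Δ^ε)(σf′) = s²·σ·(−Δ^{sε}f′)` (difference quotients with spacing `ε` versus
`sε` on the same labels; zero field, whole torus). [cite: Balaban1982Higgs1, (1.23) p.607] -/
theorem covLaplacianN_zero_rescale (hs : 0 < s) (f : ScalarField (P.scaleBy s hs) k N) (C C' : ChargeData N) :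
    covLaplacianN C Finset.univ (0 : VecField P k) (rescaleScalar hs f)
      = s ^ 2 • rescaleScalar hs (covLaplacianN (P := P.scaleBy s hs) C' Finset.univ 0 f) := by
  funext x
  rw [covLaplacianN_univ_apply, Pi.smul_apply]
  simp only [rescaleScalar]
  rw [covLaplacianN_univ_apply]
  simp only [Pi.zero_apply, neg_zero, ChargeData.U_zero, one_apply_eq_self, ← smul_sub, ← smul_add,
    ← Finset.smul_sum, smul_smul, mesh_scaleBy]
  have hs0 : s ≠ 0 := hs.ne'
  have hm : P.mesh k ≠ 0 := (P.mesh_pos k).ne'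
  have hc : (P.mesh k)⁻¹ ^ 2 * s ^ (((P.d : ℝ) - 2) / 2)
      = s ^ 2 * (s ^ (((P.d : ℝ) - 2) / 2) * (s * P.mesh k)⁻¹ ^ 2) := by
    field_simp
  rw [hc]
  rfl

/-- **The operator of (2.20) at the zero field under the rescaling**: `(−Δ^ε + μ₀² + a_k(L^kε)^{−2}P_k)(σf′) =
s²·σ·(−Δ^{sε} + μ₀²s⁻² + a_k(L^ksε)^{−2}P_k)f′` — p. 607 *"μ₀² replaced by μ₀²s⁻²"*; the `P_k`-term carries `(L^kε)^{−2}`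
and scales like the Laplacian. PROVED. [cite: Balaban1982Higgs1, (2.20) p.610] -/
theorem covOpK_zero_rescale (hs : 0 < s) (msq a : ℝ) (k : ℕ) (f : ScalarField (P.scaleBy s hs) 0 P.d) :
    covOpK (zeroCharge P.d) Finset.univ (0 : VecField P 0) msq a k (rescaleScalar (N := P.d) hs f)
      = s ^ 2 • rescaleScalar (N := P.d) hs
          (covOpK (P := P.scaleBy s hs) (zeroCharge P.d) Finset.univ 0 (msq * s⁻¹ ^ 2) a k f) := by
  unfold covOpK
  simp only [LinearMap.add_apply, LinearMap.smul_apply, LinearMap.id_apply]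
  rw [covLaplacianN_zero_rescale hs f (zeroCharge P.d) (zeroCharge P.d), projPk_zero_rescale hs k f,
    rescaleScalar_add, rescaleScalar_add, rescaleScalar_smul, rescaleScalar_smul, smul_add, smul_add, smul_smul,
    smul_smul, mesh_scaleBy, aSeq_scaleBy]
  have hs0 : s ≠ 0 := hs.ne'
  have hm : P.mesh k ≠ 0 := (P.mesh_pos k).ne'
  have h1 : s ^ 2 * (msq * s⁻¹ ^ 2) = msq := by field_simp
  have h2 : s ^ 2 * (B1.aSeq a P.L k * (s * P.mesh k)⁻¹ ^ 2) = B1.aSeq a P.L k * (P.mesh k)⁻¹ ^ 2 := by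
    field_simp
  rw [h1, h2]

/-- **The propagator (2.20) at the zero field under the rescaling** (p. 610, (2.22): *"Let us notice that the rescaled
propagator is given by G_k(Ω, A) = (−Δ^η_A + m²(Lᵏε)² + a_kP_k(A))^{−1}"*, here at a general scale factor `s`, in print
`s = (Lᵏε)^{−1}`): `G^ε_k(μ₀²)(σg′) = s⁻²·σ·G^{sε}_k(μ₀²s⁻²)g′` for `μ₀² > 0`, `a_k ≥ 0` (both operators are then
invertible, `HiggsCovariancePos`). PROVED from `G(−Δ + …) = 1` on the two lattices and `covOpK_zero_rescale`.
[cite: Balaban1982Higgs1, (2.22) p.610] -/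
theorem propagatorK_zero_rescale (hs : 0 < s) {msq : ℝ} (hmsq : 0 < msq) (a : ℝ) (k : ℕ)
    (hak : 0 ≤ B1.aSeq a P.L k) (g : ScalarField (P.scaleBy s hs) 0 P.d) :
    propagatorK (zeroCharge P.d) Finset.univ (0 : VecField P 0) msq a k (rescaleScalar (N := P.d) hs g)
      = s⁻¹ ^ 2 • rescaleScalar (N := P.d) hs
          (propagatorK (P := P.scaleBy s hs) (zeroCharge P.d) Finset.univ 0 (msq * s⁻¹ ^ 2) a k g) := by
  have hmsq' : 0 < msq * s⁻¹ ^ 2 := mul_pos hmsq (pow_pos (inv_pos.mpr hs) 2)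
  set h := propagatorK (P := P.scaleBy s hs) (zeroCharge P.d) Finset.univ 0 (msq * s⁻¹ ^ 2) a k g with hh
  have hg : g = covOpK (P := P.scaleBy s hs) (zeroCharge P.d) Finset.univ 0 (msq * s⁻¹ ^ 2) a k h :=
    (covOpK_propagatorK_apply (P := P.scaleBy s hs) (zeroCharge P.d) Finset.univ 0 hmsq' a k hak g).symm
  have hR : rescaleScalar (N := P.d) hs g
      = s⁻¹ ^ 2 • covOpK (zeroCharge P.d) Finset.univ (0 : VecField P 0) msq a k (rescaleScalar (N := P.d) hs h) := by
    rw [covOpK_zero_rescale hs msq a k h, ← hg, smul_smul]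
    have hs0 : s ≠ 0 := hs.ne'
    rw [show s⁻¹ ^ 2 * s ^ 2 = 1 by field_simp, one_smul]
  rw [hR, map_smul, propagatorK_covOpK_apply (zeroCharge P.d) Finset.univ 0 hmsq a k hak]

/-- **The combination (3.29) is scale-free**: `a_k(L^kε)^{−2}G^ε_k(μ₀²)Q^*_k(σg′) = σ·a_k(L^ksε)^{−2}G^{sε}_k(μ₀²s⁻²)Q^*_kg′`
(the factor `s⁻²` of the propagator cancels the `(L^kε)^{−2}`). PROVED. [cite: Balaban1982Higgs1, (3.29) p.617] -/
theorem fluctOp_rescale (hs : 0 < s) {msq : ℝ} (hmsq : 0 < msq) (a : ℝ) (k : ℕ) (hak : 0 ≤ B1.aSeq a P.L k)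
    (g : ScalarField (P.scaleBy s hs) k P.d) :
    fluctOp msq a k (rescaleScalar (N := P.d) hs g)
      = rescaleScalar (N := P.d) hs (fluctOp (P := P.scaleBy s hs) (msq * s⁻¹ ^ 2) a k g) := by
  rw [fluctOp_eq, fluctOp_eq, avgQkAdj_zero_rescale hs k g, propagatorK_zero_rescale hs hmsq a k hak, smul_smul]
  funext x
  simp only [Pi.smul_apply, rescaleScalar, mesh_scaleBy, aSeq_scaleBy]
  have hs0 : s ≠ 0 := hs.ne'
  have hm : P.mesh k ≠ 0 := (P.mesh_pos k).ne'
  have hc : B1.aSeq a P.L k * (P.mesh k ^ 2)⁻¹ * s⁻¹ ^ 2 = B1.aSeq a P.L k * ((s * P.mesh k) ^ 2)⁻¹ := by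
    field_simp
  rw [smul_comm, hc]
  rfl

end Operators

/-! ## 2. The background field (3.29) under the rescaling -/

section Background

/-- **`A^{(k),ε}` (3.29) is covariant under the canonical rescaling (1.22)**: for `μ₀² > 0`, `a ≥ 0`,
`A^{(k),ε}_{μ₀²}[σA′] = σ·A^{(k),sε}_{μ₀²s⁻²}[A′]` — the external field of the transformation in (3.37) on the `ε`-family,
evaluated at a rescaled level-`k` field, IS the rescaling of the external field computed on the `sε`-family with the
rescaled vector mass (p. 607). PROVED. [cite: Balaban1982Higgs1, (3.29) p.617] -/
theorem bgVec_rescale (hs : 0 < s) {mu0sq a : ℝ} (hmu : 0 < mu0sq) (ha : 0 ≤ a) (k : ℕ)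
    (A' : VecField (P.scaleBy s hs) k) :
    bgVec (P := P) mu0sq a k (rescaleVec hs A')
      = rescaleVec hs (bgVec (P := P.scaleBy s hs) (mu0sq * s⁻¹ ^ 2) a k A') := by
  unfold bgVec topPiece
  rw [toSite_rescaleVec hs A', fluctOp_rescale hs hmu a k (aSeq_nonneg (P := P) ha k), ofSite_rescaleScalar]

end Background

/-! ## 3. (3.37) → (3.38) for the model: the integral transforms into `const ×` the rescaled one -/

section Step

/-- **The double transformation of (3.37) under the rescaling**: `T^{L^kε}_{a,L}[T^{L^kε}_{a,L,A^{(k),ε}}[ρ]](σB′, σψ′) =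
rescaleFactor · T^{(sε)}_{a,L}[T^{(sε)}_{a,L,A^{(k),sε}}[ρ(σ·,σ·)]](B′, ψ′)` at the rescaled charge `e_s` and vector mass
`μ₀²s⁻²` (`HiggsDoubleRTRescale.doubleRTk_rescale` + `bgVec_rescale`). [cite: Balaban1982Higgs1, (3.38) p.619] -/
theorem doubleRTk_rescale_bg (hs : 0 < s) (C : ChargeData N) {mu0sq a : ℝ} (hmu : 0 < mu0sq) (ha : 0 ≤ a) (k : ℕ)
    (ρ : VecField P k → ScalarField P k N → ℝ) (B' : VecField (P.scaleBy s hs) (k + 1))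
    (ψ' : ScalarField (P.scaleBy s hs) (k + 1) N) :
    doubleRTk C a (fun A : VecField P k => bgVec mu0sq a k A) ρ (rescaleVec hs B') (rescaleScalar hs ψ')
      = rescaleFactor P N k s
          * doubleRTk (P := P.scaleBy s hs) (C.scaleBy P.d s) a
              (fun A' : VecField (P.scaleBy s hs) k => bgVec (mu0sq * s⁻¹ ^ 2) a k A')
              (fun A' φ' => ρ (rescaleVec hs A') (rescaleScalar hs φ')) B' ψ' :=
  doubleRTk_rescale hs C ha (ext := fun A : VecField P k => bgVec mu0sq a k A)
    (ext' := fun A' : VecField (P.scaleBy s hs) k => bgVec (mu0sq * s⁻¹ ^ 2) a k A')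
    (fun A' => bgVec_rescale hs hmu ha k A') ρ B' ψ'

/-- **(3.37) → (3.38) for the (Higgs)₂,₃ model, the change of variables**: p. 618–619, *"After the rescaling the integral
transforms into the integral const χ_{k+1}(B)χ_{k+1}(ψ)∫dA∫dφ χ_k(A)χ_k(φ)exp[…]"* — for `s > 0` (in print
`s = (L^kε)^{−1}`), `a ≥ 0`, `μ₀² > 0` and any `S`, thresholds and `m²`:
`∫dB∫dψ χ_{k+1}(B)χ_{k+1}(ψ)·T^{L^kε}_{a,L}[T^{L^kε}_{a,L,A^{(k),ε}}[χ_k(A)χ_k(φ)e^{−S}]](B,ψ)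
 = const(s) · ∫dB′∫dψ′ χ_{k+1}(σB′)χ_{k+1}(σB′,σψ′)·T_{a,L}[T_{a,L,A^{(k),sε}}[(χ_kχ_ke^{−S})(σ·,σ·)]](B′,ψ′)`
over the fields of the rescaled lattices, `const(s) = σ^{|bonds of T^{(k+1)}| + N|T^{(k+1)}|}·rescaleFactor`. PROVED.  The
further rewriting of the rescaled weights and of `S(σ·,σ·)` as the unit-lattice expressions displayed in (3.38) is not
done here. [cite: Balaban1982Higgs1, (3.38) p.619] -/
theorem integral337_rescale (hs : 0 < s) (C : ChargeData N) {mu0sq a : ℝ} (hmu : 0 < mu0sq) (ha : 0 ≤ a)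
    (msq : ℝ) (k : ℕ) (S : VecField P k → ScalarField P k N → ℝ) (ℓ₀ p₀ ℓ₁ p₁ : ℝ) :
    ∫ Ψ : VecField P (k + 1) × ScalarField P (k + 1) N,
        chiKA ℓ₁ p₁ mu0sq a (k + 1) Ψ.1 * chiKφ C ℓ₁ p₁ mu0sq msq a (k + 1) Ψ.1 Ψ.2
          * doubleRTk C a (fun A : VecField P k => bgVec mu0sq a k A) (cutoffDensity C ℓ₀ p₀ mu0sq msq a k S) Ψ.1 Ψ.2
      = (s ^ (((P.d : ℝ) - 2) / 2)) ^ (Fintype.card (PBond P (k + 1)) + N * Fintype.card (Site P (k + 1)))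
          * rescaleFactor P N k s
          * ∫ Ψ' : VecField (P.scaleBy s hs) (k + 1) × ScalarField (P.scaleBy s hs) (k + 1) N,
              chiKA ℓ₁ p₁ mu0sq a (k + 1) (rescaleVec hs Ψ'.1)
                  * chiKφ C ℓ₁ p₁ mu0sq msq a (k + 1) (rescaleVec hs Ψ'.1) (rescaleScalar hs Ψ'.2)
                * doubleRTk (P := P.scaleBy s hs) (C.scaleBy P.d s) a
                    (fun A' : VecField (P.scaleBy s hs) k => bgVec (mu0sq * s⁻¹ ^ 2) a k A')
                    (fun A' φ' => cutoffDensity C ℓ₀ p₀ mu0sq msq a k S (rescaleVec hs A') (rescaleScalar hs φ'))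
                    Ψ'.1 Ψ'.2 :=
  integral_cutoff_doubleRTk_rescale hs C ha (ext := fun A : VecField P k => bgVec mu0sq a k A)
    (ext' := fun A' : VecField (P.scaleBy s hs) k => bgVec (mu0sq * s⁻¹ ^ 2) a k A')
    (fun A' => bgVec_rescale hs hmu ha k A') (cutoffDensity C ℓ₀ p₀ mu0sq msq a k S)
    (fun B ψ => chiKA ℓ₁ p₁ mu0sq a (k + 1) B * chiKφ C ℓ₁ p₁ mu0sq msq a (k + 1) B ψ)

end Step

end Literature.MathematicalPhysics.QuantumFieldTheory.Balaban1983to89.HiggsBackgroundRescale
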